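import Summits.CriticalPhenomena.PercolationContinuityZ3.Theorems.PercNearOneGluingNoHeavyLowerTailCILOwnEdgeStability
import Summits.CriticalPhenomena.PercolationContinuityZ3.Theorems.PercNearOneGluingNoHeavyLowerTailCILRelayNeighboursSeparation
import HarnessLib

/-!
# `NoHeavyLowerTail` (stmt-CriticalPhenomena-4575) — hull-port line: gluing AT THE LEADER shrinks its lead

Support file (prover `prim-hp-1`, hull-port / coupling line; `--supports stmt-CriticalPhenomena-4575`).  No definitions,
no named facts, no sorries.

Notation: `μ_w = prodBernoulli w` on `Fin n`, relays `A`, level `j`, lightness `I_w(y) = μ_w{|π(y)| ≤ j}`, and the GAP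
`gap_w(b,q) = I_w(b) − I_w(q)`.  Own-edge stability (`CutObserver.lightness_glued_le`, `lightness_sub_ge_of_erase_edge`, prover
`prim-gen-induct`) says: opening / raising a pair AT a vertex `q` that is BEHIND `b` (`I(q) ≤ I(b)`) keeps `q` behind `b`.  This file
proves the companion statement for a vertex `q` that is AHEAD of `b`:

* `HullPort.gap_glued_leader_ge` — if `I_w(b) ≤ I_w(q)` and `w s(q,v) = 0`, then after GLUING `q` to any vertex `v`
  (`w[s(q,v) ↦ 1]`) the gap has not decreased: `I_w(b) − I_w(q) ≤ I_{w[qv↦1]}(b) − I_{w[qv↦1]}(q)` — gluing at the leader costs the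
  leader at least as much lightness as it costs anyone behind it.
* `HullPort.gap_raise_leader_ge` — the same for raising the pair `s(q,v)` from `0` to any weight (one-bond decomposition).

Proof: pull the glued events back along `ω ↦ insert s(q,v) ω`; the damage to `b` lives on `{b ~ q}` (where it equals the damage to
`q`) and on `{b ~ v, b ≁ q}`, where after gluing `b` and `q` share a cluster, so the difference of damages is
`μ(b ~ v, q light, b heavy) − μ(b ~ v, b light, q heavy)`, which is `≥ 0` by the heavy/light exchange (‡)
`CutObserver.hit_heavyLight_exchange` (van den Berg–Häggström–Kahn Thm 1.5 twice) combined with `I(b) ≤ I(q)`.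
Together with own-edge stability this gives the two-sided rule used by the hull-port programme (crux evidence
HULLPORT-COUPLING.md §4c, "Lemma A±"): raising pairs at `q` never lets `q` overtake a vertex ahead of it and never widens its lead
over a vertex behind it.  (The one-sided strengthening "the gap never decreases" is FALSE when `b` is ahead: 20/1 050 exact
counterexamples at `(|A|,j) = (5,2)`.)
[cite: VandenbergHaggstromKahn2005, Thm. 1.5 — the only probabilistic input]
-/

noncomputable section

namespace Summit.CriticalPhenomena.PercolationContinuityZ3.Theorems

open MeasureTheory Set Literature.Probability.LatticeModels Literature.Probability.Percolation
open scoped Classical BigOperators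

variable {n : ℕ}

namespace HullPort

open CutObserver ChampionStability

/-- **Gluing at the leader shrinks its lead.**  Let `q ≠ v`, `b ≠ q`, `w s(q,v) = 0`, and suppose `b` is behind `q`:
`I_w(b) ≤ I_w(q)`.  Then `I_w(b) − I_w(q) ≤ I_{w[s(q,v)↦1]}(b) − I_{w[s(q,v)↦1]}(q)`.
[cite: VandenbergHaggstromKahn2005, Thm. 1.5 (p. 7) — corollary] -/
theorem gap_glued_leader_ge (w : Sym2 (Fin n) → unitInterval) (A : Finset (Fin n)) (q v b : Fin n) (j : ℕ)
    (hqv : q ≠ v) (hbq : b ≠ q) (hw : w s(q, v) = 0)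
    (hle : (prodBernoulli w).real {ω : BondConfig (Fin n) | (A.filter fun z => ω ∈ openConn b z).card ≤ j} ≤
      (prodBernoulli w).real {ω : BondConfig (Fin n) | (A.filter fun z => ω ∈ openConn q z).card ≤ j}) :
    (prodBernoulli w).real {ω : BondConfig (Fin n) | (A.filter fun z => ω ∈ openConn b z).card ≤ j} -
        (prodBernoulli w).real {ω : BondConfig (Fin n) | (A.filter fun z => ω ∈ openConn q z).card ≤ j} ≤
      (prodBernoulli (Function.update w s(q, v) 1)).real
          {ω : BondConfig (Fin n) | (A.filter fun z => ω ∈ openConn b z).card ≤ j} -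
        (prodBernoulli (Function.update w s(q, v) 1)).real
          {ω : BondConfig (Fin n) | (A.filter fun z => ω ∈ openConn q z).card ≤ j} := by
  haveI : IsProbabilityMeasure (prodBernoulli w) := inferInstance
  set μ := prodBernoulli w with hμ
  -- relay counts before and after gluing
  set M : BondConfig (Fin n) → Fin n → ℕ := fun ω y => (A.filter fun z => (openGraph ω).Reachable y z).card with hM
  set ins : BondConfig (Fin n) → BondConfig (Fin n) := fun ω => insert s(q, v) ω with hins
  set Rb := {ω : BondConfig (Fin n) | (A.filter fun z => ω ∈ openConn b z).card ≤ j} with hRb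
  set Rq := {ω : BondConfig (Fin n) | (A.filter fun z => ω ∈ openConn q z).card ≤ j} with hRq
  have hRb' : Rb = {ω | M ω b ≤ j} := by ext ω; simp only [hRb, hM, mem_setOf_eq, openConn]
  have hRq' : Rq = {ω | M ω q ≤ j} := by ext ω; simp only [hRq, hM, mem_setOf_eq, openConn]
  set Pb := ins ⁻¹' Rb with hPb
  set Pq := ins ⁻¹' Rq with hPq
  rw [real_update_one_eq w hw Rb, real_update_one_eq w hw Rq]
  change μ.real Rb - μ.real Rq ≤ μ.real Pb - μ.real Pq
  -- monotonicity of clusters under insertion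
  have hmono : ∀ ω : BondConfig (Fin n), openGraph ω ≤ openGraph (ins ω) := by
    intro ω a c hac
    rw [openGraph_adj] at hac ⊢
    exact ⟨Set.mem_insert_of_mem _ hac.1, hac.2⟩
  have hMmono : ∀ ω y, M ω y ≤ M (ins ω) y := by
    intro ω y
    refine Finset.card_le_card fun z hz => ?_
    rw [Finset.mem_filter] at hz ⊢
    exact ⟨hz.1, hz.2.mono (hmono ω)⟩
  have hPb_sub : Pb ⊆ Rb := by
    intro ω hω
    simp only [hPb, mem_preimage, hRb'] at hω
    simp only [hRb', mem_setOf_eq]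
    exact le_trans (hMmono ω b) hω
  have hPq_sub : Pq ⊆ Rq := by
    intro ω hω
    simp only [hPq, mem_preimage, hRq'] at hω
    simp only [hRq', mem_setOf_eq]
    exact le_trans (hMmono ω q) hω
  -- events
  set Cbq := {ω : BondConfig (Fin n) | (openGraph ω).Reachable b q} with hCbq
  set F := {ω : BondConfig (Fin n) | (openGraph ω).Reachable b v} with hF
  set E := F ∩ Cbqᶜ with hE
  -- same cluster before gluing ⇒ same counts before and after
  have heq_bq : ∀ ω, ω ∈ Cbq → M ω b = M ω q ∧ M (ins ω) b = M (ins ω) q := by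
    intro ω hω
    have h1 : (A.filter fun z => (openGraph ω).Reachable b z) = (A.filter fun z => (openGraph ω).Reachable q z) :=
      Finset.filter_congr fun z _ => ⟨fun h => (SimpleGraph.Reachable.symm hω).trans h, fun h => hω.trans h⟩
    have hω' : (openGraph (ins ω)).Reachable b q := hω.mono (hmono ω)
    have h2 : (A.filter fun z => (openGraph (ins ω)).Reachable b z) =
        (A.filter fun z => (openGraph (ins ω)).Reachable q z) :=
      Finset.filter_congr fun z _ => ⟨fun h => (SimpleGraph.Reachable.symm hω').trans h, fun h => hω'.trans h⟩
    exact ⟨by rw [hM]; exact congrArg Finset.card h1, by rw [hM]; exact congrArg Finset.card h2⟩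
  -- on E (b ~ v, b ≁ q): after gluing, b ~ q, so the counts AFTER coincide
  have heq_after : ∀ ω, ω ∈ F → M (ins ω) b = M (ins ω) q := by
    intro ω hω
    have hbq' : (openGraph (ins ω)).Reachable b q := by
      rw [hins]
      rw [reachable_insert_to_left_iff ω hqv b]
      exact Or.inr hω
    have h2 : (A.filter fun z => (openGraph (ins ω)).Reachable b z) =
        (A.filter fun z => (openGraph (ins ω)).Reachable q z) :=
      Finset.filter_congr fun z _ => ⟨fun h => (SimpleGraph.Reachable.symm hbq').trans h, fun h => hbq'.trans h⟩
    rw [hM]; exact congrArg Finset.card h2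
  -- off {b ~ q} ∪ {b ~ v}: b's cluster is unchanged
  have hb_unchanged : ∀ ω, ω ∉ Cbq → ω ∉ F → M (ins ω) b = M ω b := by
    intro ω h1 h2
    have hco : ¬ (openGraph ω).Reachable b q := h1
    have hcv : ¬ (openGraph ω).Reachable b v := h2
    have h3 : (A.filter fun z => (openGraph (ins ω)).Reachable b z) = (A.filter fun z => (openGraph ω).Reachable b z) :=
      Finset.filter_congr fun z _ => reachable_insert_iff_of_not ω hqv hco hcv z
    rw [hM]; exact congrArg Finset.card h3
  -- after gluing, q's count dominates b's count whenever b ~ v (indeed they are equal); and q heavy-after when b heavy before on F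
  -- decomposition of the damages
  have hdmg_b : Rb \ Pb ⊆ ((Rq \ Pq) ∩ Cbq) ∪ (E ∩ (Rb ∩ Pqᶜ)) := by
    intro ω hω
    obtain ⟨hωR, hωP⟩ := hω
    have hωR' : M ω b ≤ j := by rw [hRb'] at hωR; exact hωR
    have hωP' : ¬ M (ins ω) b ≤ j := by
      intro h; apply hωP; simp only [hPb, mem_preimage, hRb', mem_setOf_eq]; exact h
    by_cases h1 : ω ∈ Cbq
    · left
      obtain ⟨e1, e2⟩ := heq_bq ω h1
      refine ⟨⟨?_, ?_⟩, h1⟩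
      · rw [hRq']; simp only [mem_setOf_eq]; rw [← e1]; exact hωR'
      · intro h; apply hωP'; simp only [hPq, mem_preimage, hRq', mem_setOf_eq] at h; rw [e2]; exact h
    · by_cases h2 : ω ∈ F
      · right
        refine ⟨⟨h2, h1⟩, hωR, ?_⟩
        intro h; apply hωP'
        simp only [hPq, mem_preimage, hRq', mem_setOf_eq] at h
        rw [heq_after ω h2]; exact h
      · exact absurd (by rw [hb_unchanged ω h1 h2]; exact hωR') hωP'
  have hdmg_q : ((Rq \ Pq) ∩ Cbq) ∪ (E ∩ (Rq ∩ Pqᶜ)) ⊆ Rq \ Pq := by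
    rintro ω (⟨h, _⟩ | ⟨_, h1, h2⟩)
    · exact h
    · exact ⟨h1, h2⟩
  have hdisj_q : Disjoint ((Rq \ Pq) ∩ Cbq) (E ∩ (Rq ∩ Pqᶜ)) := by
    rw [Set.disjoint_left]
    rintro ω ⟨_, h1⟩ ⟨⟨_, h2⟩, _⟩
    exact h2 h1
  -- light/heavy cells
  set X := {ω : BondConfig (Fin n) | M ω b ≤ j ∧ j < M ω q} with hX   -- b light, q heavy
  set Y := {ω : BondConfig (Fin n) | M ω q ≤ j ∧ j < M ω b} with hY   -- q light, b heavy
  have hgap : μ.real Rb - μ.real Rq = μ.real X - μ.real Y := by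
    have e1 : Rb = (Rb ∩ Rq) ∪ X := by
      ext ω; simp only [hRb', hRq', hX, mem_union, mem_inter_iff, mem_setOf_eq]; constructor
      · intro h; by_cases h' : M ω q ≤ j
        · exact Or.inl ⟨h, h'⟩
        · exact Or.inr ⟨h, by omega⟩
      · rintro (⟨h, _⟩ | ⟨h, _⟩) <;> exact h
    have e2 : Rq = (Rb ∩ Rq) ∪ Y := by
      ext ω; simp only [hRb', hRq', hY, mem_union, mem_inter_iff, mem_setOf_eq]; constructor
      · intro h; by_cases h' : M ω b ≤ j
        · exact Or.inl ⟨h', h⟩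
        · exact Or.inr ⟨h, by omega⟩
      · rintro (⟨_, h⟩ | ⟨h, _⟩) <;> exact h
    have d1 : Disjoint (Rb ∩ Rq) X := by
      rw [Set.disjoint_left]; rintro ω ⟨_, h⟩ ⟨_, h'⟩
      simp only [hRq', mem_setOf_eq] at h; omega
    have d2 : Disjoint (Rb ∩ Rq) Y := by
      rw [Set.disjoint_left]; rintro ω ⟨h, _⟩ ⟨_, h'⟩
      simp only [hRb', mem_setOf_eq] at h; omega
    have m1 := measureReal_union d1 (MeasurableSet.of_discrete (s := X)) (μ := μ)
    have m2 := measureReal_union d2 (MeasurableSet.of_discrete (s := Y)) (μ := μ)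
    rw [← e1] at m1; rw [← e2] at m2
    linarith
  -- the key cells on E
  have hXE : E ∩ (Rb ∩ Pqᶜ) ⊆ (F ∩ X) ∪ (E ∩ (Rb ∩ Rq ∩ Pqᶜ)) := by
    rintro ω ⟨hωE, hωR, hωP⟩
    by_cases h : M ω q ≤ j
    · right; refine ⟨hωE, ⟨hωR, ?_⟩, hωP⟩; rw [hRq']; exact h
    · left; refine ⟨hωE.1, ?_, by omega⟩; rw [hRb'] at hωR; exact hωR
  have hYE : (F ∩ Y) ∪ (E ∩ (Rb ∩ Rq ∩ Pqᶜ)) ⊆ E ∩ (Rq ∩ Pqᶜ) := by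
    rintro ω (⟨hωF, hq, hb⟩ | ⟨hωE, ⟨_, hωRq⟩, hωP⟩)
    · -- b heavy, q light before; b ~ v; then b ≁ q and q is heavy after (its glued cluster contains b's)
      have hnbq : ω ∉ Cbq := by
        intro h'
        have := (heq_bq ω h').1
        omega
      refine ⟨⟨hωF, hnbq⟩, ?_, ?_⟩
      · rw [hRq']; exact hq
      · intro h'
        simp only [hPq, mem_preimage, hRq', mem_setOf_eq] at h'
        have e := heq_after ω hωF
        have := hMmono ω b
        omega
    · exact ⟨hωE, hωRq, hωP⟩
  have hdisjY : Disjoint (F ∩ Y) (E ∩ (Rb ∩ Rq ∩ Pqᶜ)) := by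
    rw [Set.disjoint_left]
    rintro ω ⟨_, _, hb⟩ ⟨_, ⟨hRbω, _⟩, _⟩
    rw [hRb'] at hRbω; simp only [mem_setOf_eq] at hRbω; omega
  -- (‡): μ(F ∩ X)·μ(Y) ≤ μ(F ∩ Y)·μ(X)
  have hdd := hit_heavyLight_exchange w A hbq {v} j
  have eF : {ω : BondConfig (Fin n) | ∃ m ∈ ({v} : Finset (Fin n)), (openGraph ω).Reachable b m} = F := by
    ext ω; simp only [hF, Finset.mem_singleton, exists_eq_left, mem_setOf_eq]
  rw [eF] at hdd
  change μ.real (F ∩ X) * μ.real Y ≤ μ.real (F ∩ Y) * μ.real X at hdd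
  have hXY : μ.real X ≤ μ.real Y := by linarith
  have hFXY : μ.real (F ∩ X) ≤ μ.real (F ∩ Y) := by
    by_cases hY0 : μ.real Y = 0
    · have hX0 : μ.real X ≤ 0 := by rw [← hY0]; exact hXY
      have : μ.real (F ∩ X) ≤ μ.real X := measureReal_mono inter_subset_right (measure_ne_top _ _)
      linarith [measureReal_nonneg (μ := μ) (s := F ∩ Y)]
    · have hYpos : 0 < μ.real Y := lt_of_le_of_ne measureReal_nonneg (Ne.symm hY0)
      have h2 : μ.real (F ∩ Y) * μ.real X ≤ μ.real (F ∩ Y) * μ.real Y :=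
        mul_le_mul_of_nonneg_left hXY measureReal_nonneg
      exact le_of_mul_le_mul_right (hdd.trans h2) hYpos
  -- assemble: dmg_b ≤ dmg_q
  have hPb_diff : μ.real Rb - μ.real Pb = μ.real (Rb \ Pb) := by
    have := measureReal_inter_add_sdiff (μ := μ) (s := Rb) (MeasurableSet.of_discrete (s := Pb)) (measure_ne_top _ _)
    rw [inter_eq_self_of_subset_right hPb_sub] at this; linarith
  have hPq_diff : μ.real Rq - μ.real Pq = μ.real (Rq \ Pq) := by
    have := measureReal_inter_add_sdiff (μ := μ) (s := Rq) (MeasurableSet.of_discrete (s := Pq)) (measure_ne_top _ _)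
    rw [inter_eq_self_of_subset_right hPq_sub] at this; linarith
  have h1 : μ.real (Rb \ Pb) ≤ μ.real ((Rq \ Pq) ∩ Cbq) + μ.real (E ∩ (Rb ∩ Pqᶜ)) :=
    (measureReal_mono hdmg_b (measure_ne_top _ _)).trans (measureReal_union_le _ _)
  have h2 : μ.real ((Rq \ Pq) ∩ Cbq) + μ.real (E ∩ (Rq ∩ Pqᶜ)) ≤ μ.real (Rq \ Pq) := by
    rw [← measureReal_union hdisj_q MeasurableSet.of_discrete]
    exact measureReal_mono hdmg_q (measure_ne_top _ _)
  have h3 : μ.real (E ∩ (Rb ∩ Pqᶜ)) ≤ μ.real (F ∩ X) + μ.real (E ∩ (Rb ∩ Rq ∩ Pqᶜ)) :=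
    (measureReal_mono hXE (measure_ne_top _ _)).trans (measureReal_union_le _ _)
  have h4 : μ.real (F ∩ Y) + μ.real (E ∩ (Rb ∩ Rq ∩ Pqᶜ)) ≤ μ.real (E ∩ (Rq ∩ Pqᶜ)) := by
    rw [← measureReal_union hdisjY MeasurableSet.of_discrete]
    exact measureReal_mono hYE (measure_ne_top _ _)
  linarith

/-- **Raising a pair at the leader shrinks its lead.**  Let `q ≠ v`, `b ≠ q`, `e = s(q,v)`, `w₀ = w[e ↦ 0]`.  If
`I_{w₀}(b) ≤ I_{w₀}(q)` then `I_{w₀}(b) − I_{w₀}(q) ≤ I_w(b) − I_w(q)`: by the one-bond decomposition and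
`gap_glued_leader_ge`. [cite: VandenbergHaggstromKahn2005, Thm. 1.5 (p. 7) — corollary] -/
theorem gap_raise_leader_ge (w : Sym2 (Fin n) → unitInterval) (A : Finset (Fin n)) (q v b : Fin n) (j : ℕ)
    (hqv : q ≠ v) (hbq : b ≠ q)
    (hle : (prodBernoulli (Function.update w s(q, v) 0)).real
          {ω : BondConfig (Fin n) | (A.filter fun z => ω ∈ openConn b z).card ≤ j} ≤
        (prodBernoulli (Function.update w s(q, v) 0)).real
          {ω : BondConfig (Fin n) | (A.filter fun z => ω ∈ openConn q z).card ≤ j}) :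
    (prodBernoulli (Function.update w s(q, v) 0)).real
          {ω : BondConfig (Fin n) | (A.filter fun z => ω ∈ openConn b z).card ≤ j} -
        (prodBernoulli (Function.update w s(q, v) 0)).real
          {ω : BondConfig (Fin n) | (A.filter fun z => ω ∈ openConn q z).card ≤ j} ≤
      (prodBernoulli w).real {ω : BondConfig (Fin n) | (A.filter fun z => ω ∈ openConn b z).card ≤ j} -
        (prodBernoulli w).real {ω : BondConfig (Fin n) | (A.filter fun z => ω ∈ openConn q z).card ≤ j} := by
  set e : Sym2 (Fin n) := s(q, v) with he
  set w₀ := Function.update w e 0 with hw₀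
  set Rb := {ω : BondConfig (Fin n) | (A.filter fun z => ω ∈ openConn b z).card ≤ j} with hRb
  set Rq := {ω : BondConfig (Fin n) | (A.filter fun z => ω ∈ openConn q z).card ≤ j} with hRq
  have hw₀e : w₀ s(q, v) = 0 := by simp [hw₀, he]
  have hw₁ : Function.update w e 1 = Function.update w₀ s(q, v) 1 := by
    rw [hw₀, he, Function.update_idem]
  have hglue := gap_glued_leader_ge w₀ A q v b j hqv hbq hw₀e hle
  have hp0 : 0 ≤ (w e : ℝ) := (w e).2.1
  have hp1 : (w e : ℝ) ≤ 1 := (w e).2.2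
  rw [stub_oneBondDecomp_k15 n w e Rb, stub_oneBondDecomp_k15 n w e Rq, hw₁]
  have h := mul_le_mul_of_nonneg_left hglue hp0
  nlinarith [h, hglue, hp0, hp1]

end HullPort

end Summit.CriticalPhenomena.PercolationContinuityZ3.Theorems

end
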